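import Summits.BirchSwinnertonDyer.BirchSwinnertonDyer.Theorems.KatoDescentTamePotSupersingularJetchevIrreducibleReadingThm52Bricks
import Summits.BirchSwinnertonDyer.Rank1Residual.JET.GrossProp53Kolyvagin
import Literature.NumberTheory.EllipticCurves.HeegnerPointsOfConductorRationalityProofs
import Literature.NumberTheory.EllipticCurves.RingClassGalOverCyclicProofs
import HarnessLib

/-!
# Crux `JetchevIrreducibleReadingByName` (item 20165, shared K8-t′ / K9) and crux `WildJetchevBoundAtP` (item 19941, K9):
# the SIGN of the Kolyvagin class on an IRREDUCIBLE row, UNCONDITIONAL — Gross 1991 Prop. 5.4 (1) `τ_* c_k(c) = e·c_k(c)`,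
# `e = −w(E)(−1)^{#primes of c}`, for `E[p]` irreducible with `p ∣ N_E`, WITHOUT the named-print binder `h53` (Gross Prop. 5.3
# schema) and WITHOUT the two Gross §3 CM facts as hypotheses — seat `bsd-potss-k9-c4` g9; route-free; `--supports 20165`,
# helper; nothing booked, no item closed, BSD is not proved by any of this

WHY. The irreducible H63 line of the two cruxes (k8t-c4 g8/g9 `…Thm52KernelInputsCebotarev` p519470 → k9-c4 g8
`…JetchevIrreducibleLocalFacts` p525480 → the NamedPrint end forms p531200 / p532411) displays Gross's Prop. 5.3 as the
UNGUARDED schema `h53 : ∃ ε = ±1, ∀ m, ∀ dm, ∀ τm, ∃ σ′ ∈ 𝒢_m, τm·y(m) − ε·σ′·y(m) torsion` — stronger than print (`m = 0`,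
`gcd(m, N) > 1` included) and not derivable as closed (`JET/GrossProp53Kolyvagin.lean`, module docstring). But the ONLY
consumer of `h53` on that line is the sign lemma `JetchevIrreducibleReadingThm52Bricks.exists_sign_conjAct_kolyvaginClass_of_prop53_of_irreducible`
(k8t-c4 g8, p507503), which feeds x11b3's `conjAct_kolyvaginClass_eq_sign_smul_zhang` with Prop. 5.3 AT THE DIVISORS OF THE
KOLYVAGIN CONDUCTOR `c` only — all `≠ 0` and prime to `N` (`JET.ne_zero_and_coprime_of_isKolyvaginPrime`), where Prop. 5.3 is
the tree THEOREM `JET.exists_mem_ringClassGal_isOfFinAddOrder_conj_sub_smul` (bsd-jet read-1 g10, p525846: x11b3's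
`KolyvaginA53.h53_of_recM` + Shimura reciprocity at conductor `m`). So — exactly as bsd-jet's `JET.sign_conjAct_kolyvaginClass`
(p527071) did for the SURJECTIVE-image line — the sign is UNCONDITIONAL on the irreducible line too, with the admissibility
`E(K[m])[p] = 0` from irreducibility + `p ∣ N_E` (k8t-c4 g8's `isAdmissible_of_irreducible_of_dvd_conductorNorm`) in place of
surjectivity, and the two CM facts discharged by their `_holds` theorems.

WHAT IS PROVED. `sign_conjAct_kolyvaginClass_of_irreducible`: for `W/ℚ` elliptic globally minimal, `K` imaginary quadratic
with `d_K ∉ {−3, −4}` and the Heegner hypothesis for `N_E`, an odd prime `p ∣ N_E` with `E[p]` irreducible, the non-trivial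
`τ ∈ Aut(K/ℚ)`, a frame `(Dt, β, ι)`, a square-free `c` all of whose prime factors are Zhang–Kolyvagin primes of index
`≥ k ≥ 1`, and ANY datum `d` of conductor `c`: `e := −w(E)·(−1)^{#c.primeFactors} ∈ {±1}` and `τ_* c_k(c) = e • c_k(c)`.
`exists_sign_conjAct_kolyvaginClass_of_irreducible`: the `∃ ε = ±1` form in the exact output shape of k8t-c4's
`exists_sign_conjAct_kolyvaginClass_of_prop53_of_irreducible` (so the kernel-inputs assembly re-elaborates with `ε`, `hε`, `h53`
deleted). CONSEQUENCE (accounting, both cruxes): `h53` can leave the displayed inputs of `stub_thm52…` — the gaps stub becomes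
named print {`hPT`, `hGZ`} + ONE completion-layer gap `h49str` (sequel files). HONEST FRAMING: a sign computation; conditional
on nothing but its row hypotheses; nothing asserted about any curve; 20165, 19941, their stubs and BSD stay open.

References: [cite: GrossLMS1991, §5 Prop. 5.3, Prop. 5.4 (1) (p. 243); §3 (3.1) (pp. 238–239)] [cite: Jetchev2008, §4.1.3 (ε(c)),
proof of Thm. 5.2 (p. 822)] [cite: WZhang2014, Notations (xii)].
-/

set_option autoImplicit false
-- the Theorems directory repeats the summit name (sibling precedent `KatoDescentPotSupersingularAssembly.lean`)
set_option linter.dupNamespace false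

noncomputable section

open scoped Classical
open WeierstrassCurve Field NumberField IsDedekindDomain Finset
open Literature.NumberTheory.EllipticCurves Literature.NumberTheory.GaloisRepresentations
open Literature.NumberTheory.EllipticCurves.KolyvaginCocycle Literature.NumberTheory.EllipticCurves.KolyvaginEuler
open Literature.NumberTheory.EllipticCurves.RingClassField Literature.NumberTheory.EllipticCurves.ModularForms
open Summit.BirchSwinnertonDyer.Rank1Residual.X11b Summit.BirchSwinnertonDyer.Rank1Residual.X11b.Three
open Summit.BirchSwinnertonDyer.Rank1Residual.X11b.Three.GrossBadPlace
open Summit.BirchSwinnertonDyer.Rank1Residual.X11b.KolyvaginHloc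
open Summit.BirchSwinnertonDyer.Rank1Residual.JET

namespace Summit.BirchSwinnertonDyer.BirchSwinnertonDyer.Theorems.JetchevIrreducibleReadingSign

-- `K : Type`: the tree's ring-class class field theory is universe `0`.
variable {K : Type} [Field K] [NumberField K] {W : WeierstrassCurve ℚ}

/-- **Gross 1991 Prop. 5.4 (1) for the concrete class on an IRREDUCIBLE row, UNCONDITIONAL**: for `E/ℚ` globally minimal,
`K` imaginary quadratic with `d_K ∉ {−3, −4}` and the Heegner hypothesis for `N = N_E`, an odd prime `p ∣ N_E` with `E[p]`
irreducible, the non-trivial `τ ∈ Aut(K/ℚ)`, a frame `(Dt, β, ι)`, a square-free conductor `c` all of whose prime factors are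
Kolyvagin primes of index `≥ k ≥ 1`, and ANY datum `d` of conductor `c`: `τ_* c_k(c) = e • c_k(c)` with
`e = −w(E)·(−1)^{#primes of c} ∈ {±1}` — k8t-c4's `exists_sign_conjAct_kolyvaginClass_of_prop53_of_irreducible` at `ε = −w(E)`
with `h53` discharged by `JET.exists_mem_ringClassGal_isOfFinAddOrder_conj_sub_smul` at every divisor of `c` and the two CM facts
by their `_holds` theorems. [cite: GrossLMS1991, §5 Prop. 5.3, Prop. 5.4 (1) (p. 243)] [cite: Jetchev2008, §4.1.3 (ε(c))] -/
theorem sign_conjAct_kolyvaginClass_of_irreducible [W.IsElliptic] [W.IsGloballyMinimal] [NeZero (W.conductorNorm ℤ)]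
    (hK : IsImaginaryQuadratic K) (hD3 : NumberField.discr K ≠ -3) (hD4 : NumberField.discr K ≠ -4)
    (hH : SatisfiesHeegnerHypothesis (W.conductorNorm ℤ) K)
    {p : ℕ} [Fact p.Prime] (hp2 : p ≠ 2) (hirr : W.HasIrreducibleModPGaloisRep p)
    (hpN : p ∣ W.conductorNorm ℤ)
    (τ : K ≃ₐ[ℚ] K) (hτ : τ ≠ 1)
    (Dt : ModularParametrizationData W (W.conductorNorm ℤ)) (β : ℤ) (ι : K →+* ℂ)
    {c : ℕ} (hc : Squarefree c) {k : ℕ} (hk : 1 ≤ k)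
    (hcK : ∀ ℓ ∈ c.primeFactors, Zhang2014.IsKolyvaginPrime (W.conductorNorm ℤ) W K p ℓ ∧
      k ≤ Zhang2014.kolyvaginIndex W p ℓ)
    (d : KolyvaginHeegnerData Dt β ι c) :
    (-W.rootNumber * (-1) ^ c.primeFactors.card = 1 ∨ -W.rootNumber * (-1) ^ c.primeFactors.card = -1) ∧
      conjAct W τ ((p ^ k : ℕ) : ℤ) (d.kolyvaginClass (Fact.out : p.Prime) k) =
        (-W.rootNumber * (-1) ^ c.primeFactors.card) • d.kolyvaginClass (Fact.out : p.Prime) k := by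
  have hp : p.Prime := Fact.out
  have hCM1 : phi_heegnerPointOfConductor_mem_range_map_ringClassField (W.conductorNorm ℤ) W K :=
    phi_heegnerPointOfConductor_mem_range_map_ringClassField_holds (W.conductorNorm ℤ) W K
  have hCM2 : exists_generator_ringClassGalOver K := exists_generator_ringClassGalOver_holds
  have hND : IsCoprime (W.conductorNorm ℤ : ℤ) (NumberField.discr K) :=
    KolyvaginAssembly.isCoprime_discr_of_satisfiesHeegnerHypothesis hK hH
  have hD : NumberField.discr K < -4 := KolyvaginAssembly.discr_lt_neg_four hK ⟨hD3, hD4⟩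
  have hinert : ∀ (m' : ℕ), m' ∣ c → ∀ q ∈ m'.primeFactors, (Ideal.span {(q : 𝓞 K)}).IsPrime :=
    fun m' hm' q hq ↦ (hcK q (Nat.primeFactors_mono hm' hc.ne_zero hq)).1.2.2.2.2.1
  -- data at every divisor of `c` (the given `d` at `c` itself)
  have hne : ∀ m' : ℕ, m' ∣ c → Nonempty (KolyvaginHeegnerData Dt β ι m') := fun m' hm' ↦
    BirchSwinnertonDyer.Theorems.nonempty_kolyvaginHeegnerData_of_grossCM hCM1 hCM2 hK hH Dt β ι
      d.dvd_sq_sub (hc.squarefree_of_dvd hm') (hinert m' hm')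
  let data : (m' : ℕ) → m' ∣ c → KolyvaginHeegnerData Dt β ι m' := fun m' hm' ↦
    if h : m' = c then h ▸ d else (hne m' hm').some
  have hdata : data c dvd_rfl = d := by simp [data]
  -- Gross Prop. 5.3 at every divisor of `c` (all `≠ 0` and prime to `N`), UNCONDITIONALLY (p525846)
  have h53 : ∀ (m : ℕ) (hm : m ∣ c) (τm : ringClassField K ι m ≃ₐ[ℚ] ringClassField K ι m),
      (∀ x : ringClassField K ι m, ((τm x : ringClassField K ι m) : ℂ) = starRingEnd ℂ x) →
      ∃ σ' ∈ ringClassGal ι m, IsOfFinAddOrder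
        (pointGalHom W (ringClassField K ι m) τm (data m hm).y -
          (-W.rootNumber) • pointGalHom W (ringClassField K ι m) σ' (data m hm).y) := by
    intro m hm τm hτm
    obtain ⟨hm0, hmN⟩ := ne_zero_and_coprime_of_isKolyvaginPrime (K := K) (hc.squarefree_of_dvd hm)
      (fun q hq ↦ (hcK q (Nat.primeFactors_mono hm hc.ne_zero hq)).1)
    exact exists_mem_ringClassGal_isOfFinAddOrder_conj_sub_smul W hK hH Dt ι hm0 hmN (data m hm) τm hτm
  refine ⟨?_, ?_⟩
  · rcases W.rootNumber_eq_one_or with h1 | h1 <;>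
      rcases neg_one_pow_eq_or ℤ c.primeFactors.card with h | h <;> simp [h1, h]
  · have h := conjAct_kolyvaginClass_eq_sign_smul_zhang (c := τ) hK ι hp hk Dt hND hD hc hcK data hτ
      (-W.rootNumber) h53
      (fun m hm ↦ JetchevIrreducibleReadingThm52Bricks.isAdmissible_of_irreducible_of_dvd_conductorNorm hK hH hp
        hp2 hirr hpN hc hcK data m hm)
      c dvd_rfl
    rwa [hdata] at h

/-- **The same in the `∃ ε ∈ {±1}` output shape of k8t-c4's
`JetchevIrreducibleReadingThm52Bricks.exists_sign_conjAct_kolyvaginClass_of_prop53_of_irreducible`** (with `ε := −w(E)`), so the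
kernel-inputs assembly re-elaborates with `(ε, hε, h53)` replaced by this theorem. [cite: GrossLMS1991, §5 Prop. 5.4 (1) (p. 243)] -/
theorem exists_sign_conjAct_kolyvaginClass_of_irreducible [W.IsElliptic] [W.IsGloballyMinimal] [NeZero (W.conductorNorm ℤ)]
    (hK : IsImaginaryQuadratic K) (hD3 : NumberField.discr K ≠ -3) (hD4 : NumberField.discr K ≠ -4)
    (hH : SatisfiesHeegnerHypothesis (W.conductorNorm ℤ) K)
    {p : ℕ} [Fact p.Prime] (hp2 : p ≠ 2) (hirr : W.HasIrreducibleModPGaloisRep p)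
    (hpN : p ∣ W.conductorNorm ℤ)
    (τ : K ≃ₐ[ℚ] K) (hτ : τ ≠ 1)
    (Dt : ModularParametrizationData W (W.conductorNorm ℤ)) (β : ℤ) (ι : K →+* ℂ)
    {c : ℕ} (hc : Squarefree c) {k : ℕ} (hk : 1 ≤ k)
    (hcK : ∀ ℓ ∈ c.primeFactors, Zhang2014.IsKolyvaginPrime (W.conductorNorm ℤ) W K p ℓ ∧
      k ≤ Zhang2014.kolyvaginIndex W p ℓ)
    (d : KolyvaginHeegnerData Dt β ι c) :
    ∃ ε : ℤ, (ε = 1 ∨ ε = -1) ∧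
      (ε * (-1) ^ c.primeFactors.card = 1 ∨ ε * (-1) ^ c.primeFactors.card = -1) ∧
      conjAct W τ ((p ^ k : ℕ) : ℤ) (d.kolyvaginClass (Fact.out : p.Prime) k) =
        (ε * (-1) ^ c.primeFactors.card) • d.kolyvaginClass (Fact.out : p.Prime) k := by
  refine ⟨-W.rootNumber, ?_, sign_conjAct_kolyvaginClass_of_irreducible hK hD3 hD4 hH hp2 hirr hpN τ hτ Dt β ι
    hc hk hcK d⟩
  rcases W.rootNumber_eq_one_or with h | h <;> simp [h]

end Summit.BirchSwinnertonDyer.BirchSwinnertonDyer.Theorems.JetchevIrreducibleReadingSign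

end
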